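import Summits.CriticalPhenomena.PercolationContinuityZ3.Theorems.PercNearOneGluingNoHeavyLowerTailSahiGridPatternDiagRouteTopCube
import Summits.CriticalPhenomena.PercolationContinuityZ3.Theorems.PercNearOneGluingNoHeavyLowerTailSahiGridPatternDiagCertBlockAndT

/-!
# `NoHeavyLowerTail` (crux stmt-CriticalPhenomena-4575), Sahi programme P1: **BA₀(S) FULLY DISCHARGED** — for every top-cube up-set `S ⊆ [3]^n` and every
# DIAGONALLY CERTIFIED up-set `V ⊆ [3]^k` (a vector `d ≥ 0` with (T) and (N)), `2^n·1_S ⊗ d` is a diagonal certificate of `S × V`, and `[3]^m × (S × V)` is a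
# good first slot of the pattern functional in every dimension `m`

Support file (Sahi cell, seat `prim-sahi-p1`, generation 31; `--supports stmt-CriticalPhenomena-4575`).  Pure proofs, NO definitions, no `sorry`, standard axioms.
Combines `…DiagRouteTopCube` (CONJECTURE D: (N) for `2^n·1_S ⊗ d`, generation 31) with `…DiagCertBlockAndT.diagCert_blockAnd_T` ((T) for `2^n·1_S ⊗ d`, generation 29),
so that the block-AND step needs no hypothesis beyond a certificate of `V`: the class of diagonally certified up-sets is closed under `S × (·)` for every up-set
`S` of every top cube `{1,2}^n`.  Nothing here asserts `PatternPos d` for `d ≥ 4`. [this work]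
-/

namespace Summit.CriticalPhenomena.PercolationContinuityZ3.Theorems.SahiGridPattern

open Finset SahiGrid3
open scoped BigOperators

variable {n k : ℕ} {S : Finset (Pd n)} {V : Finset (Pd k)} {A : Finset (Pd (n + k))}

/-- **(T) and (N) for `2^n·1_S ⊗ d` on `S × V`** (every top-cube up-set `S`, every diagonally certified `V`): the block product is diagonally certified. [this work] -/
theorem diagCert_blockAnd_topCube (hS : IsUpperSet (S : Set (Pd n))) (htop : ∀ ξ ∈ S, ∀ a, ξ a ≠ 0) (hV : IsUpperSet (V : Set (Pd k)))
    (hA : ∀ ξ z, glue ξ z ∈ A ↔ (ξ ∈ S ∧ z ∈ V)) (d : Pd k → ℤ) (hd : ∀ q, 0 ≤ d q)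
    (hT : ∀ W : Finset (Pd k), IsUpperSet (W : Set (Pd k)) → (∑ q ∈ W, d q) ≤ ∑ q ∈ W, lamU V q)
    (hN : ∀ X X' : Finset (Pd k), IsUpperSet (X : Set (Pd k)) → IsUpperSet (X' : Set (Pd k)) → (∑ q ∈ X, ∑ r ∈ X', thetaVal V q r) ≤ ∑ q ∈ X ∩ X', d q) :
    (∀ x : Pd (n + k), 0 ≤ (2:ℤ) ^ n * ind S (freeOf x) * d (cellOf x)) ∧
    (∀ W : Finset (Pd (n + k)), IsUpperSet (W : Set (Pd (n + k))) → (∑ x ∈ W, (2:ℤ) ^ n * ind S (freeOf x) * d (cellOf x)) ≤ ∑ x ∈ W, lamU A x) ∧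
    (∀ P Q : Finset (Pd (n + k)), IsUpperSet (P : Set (Pd (n + k))) → IsUpperSet (Q : Set (Pd (n + k))) →
      (∑ x ∈ P, ∑ y ∈ Q, thetaVal A x y) ≤ ∑ x ∈ P ∩ Q, (2:ℤ) ^ n * ind S (freeOf x) * d (cellOf x)) :=
  ⟨fun x => mul_nonneg (mul_nonneg (pow_nonneg (by norm_num) n) (ind_nonneg' S (freeOf x))) (hd (cellOf x)),
   fun _ hW => diagCert_blockAnd_T hA hS d hT hW,
   fun _ _ hP hQ => diagCert_blockAnd_N_topCube hS htop hV hA d hd hN hP hQ⟩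

/-- **THEOREM BA₀(S), fully discharged (every `n, k, m`).**  For an up-set `S ⊆ [3]^n` with no zero coordinate, an up-set `V ⊆ [3]^k` carrying a diagonal certificate
`d ≥ 0` ((T): `d(W) ≤ λ_V(W)` for up-sets `W`; (N): `Θ_V(X×X') ≤ d(X∩X')` for up-sets `X, X'`), and `A = S × V`:  `0 ≤ sStarD ([3]^m × A) B C` for all up-sets
`B, C ⊆ [3]^{m+(n+k)}`. [this work] -/
theorem sStarD_blockAnd_topCube_cylSet_nonneg' {m : ℕ} (hS : IsUpperSet (S : Set (Pd n))) (htop : ∀ ξ ∈ S, ∀ a, ξ a ≠ 0) (hV : IsUpperSet (V : Set (Pd k)))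
    (hA : ∀ ξ z, glue ξ z ∈ A ↔ (ξ ∈ S ∧ z ∈ V)) (d : Pd k → ℤ) (hd : ∀ q, 0 ≤ d q)
    (hT : ∀ W : Finset (Pd k), IsUpperSet (W : Set (Pd k)) → (∑ q ∈ W, d q) ≤ ∑ q ∈ W, lamU V q)
    (hN : ∀ X X' : Finset (Pd k), IsUpperSet (X : Set (Pd k)) → IsUpperSet (X' : Set (Pd k)) → (∑ q ∈ X, ∑ r ∈ X', thetaVal V q r) ≤ ∑ q ∈ X ∩ X', d q)
    {B C : Finset (Pd (m + (n + k)))} (hB : IsUpperSet (B : Set (Pd (m + (n + k))))) (hC : IsUpperSet (C : Set (Pd (m + (n + k))))) :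
    0 ≤ sStarD (cylSet A : Finset (Pd (m + (n + k)))) B C :=
  sStarD_blockAnd_topCube_cylSet_nonneg hS htop hV hA d hd hN (fun _ hW => diagCert_blockAnd_T hA hS d hT hW) hB hC

end Summit.CriticalPhenomena.PercolationContinuityZ3.Theorems.SahiGridPattern
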